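import Summits.HodgeConjecture.HodgeConjecture.Theorems.Ring2AbelianAllLefschetzPencilsQuasiInverse
import Summits.HodgeConjecture.HodgeConjecture.Theorems.Ring2AbelianAllLefschetzPencilsOnPath
import HarnessLib

/-!
# Ring 2 · sub-cell AbelianAll (ALL ABELIAN VARIETIES), André axis — ab-andre-1 part XII: the supply node of
# the edge `(5) ⟹ (β′)` CUT DOWN TO ITS HODGE-THEORETIC CORE `(Q_H)` and put ON THE PATH of the summit —
# `HodgeConjecture ⟹ (Q_H)` in the kernel — so that the whole bracket of `(5) ⟹[Q_H; κ, φ] (β′)` is a case of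
# the Hodge conjecture

HONEST FRAMING (page 1, verbatim): **research route, not a corollary; conditional on HC_CM plus one named
minimal statement.** Cell line: research route conditional on HC_CM; not a corollary; Q11.4-sentence-2
already refuted in dim ≥ 3. Nothing in this file proves an open case of the Hodge conjecture; `HC_CM`
(`RankFourFaces.CMAbelianHodge`) and `HC_AV` (`PadicSemiregularLift.HodgeAbelianVarieties`) occur only as binders,
and `_root_.HodgeConjecture` only as the HYPOTHESIS of on-path lemmas. Seat `pub-hodge-ring2-ab-andre-1`, gen 8;
sequel of part XI (`Ring2AbelianAllLefschetzPencilsQuasiInverse`, the supply node (Q) and the edges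
`(5∀)/(5)/(5)_d ⟹[Q; κ, φ] (β…)`), of part VI (`Ring2AbelianAllLefschetzPencilsOnPath`, `HodgeConjecture ⟹ (5∀)`)
and of ab-andre-2's parts X-a/X-b (`Ring2AbelianAllAndrePseudoInverse`, `Ring2AbelianAllAndreFibreClassOnPath`),
all cited by name, never copied. Answers REFEREE-AB R-10 F-ab-37 on the kernel side: the edge `(5) ⟹ (β′)` is
kernel modulo typed supply nodes, and after this part every bracket of it is itself ON THE PATH of the summit.

## What this part adds

Part XI's node (Q) `AlgebraicQuasiInverseOfLefschetzStandard` asks, under `B(X)`, an algebraic quasi-inverse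
for EVERY map `Hᵃ → Hᵇ` in the `ℂ`-span of the actions of algebraic classes on `X × X`. The rows of part XI use
it only for `u = L_t = j_{t*} j_t^* = (· ∪ [𝒳_t])`, which is much better than a general element of that span: it
is RATIONAL and of pure Hodge bidegree `(1, 1)` (ab-andre-2 X-b §3). This part records the weaker node that the
rows actually consume and proves that the weaker node is a CASE OF THE SUMMIT:

* §S **(Q_H) `AlgebraicQuasiInverseOfLefschetzStandardHodge`**: for `X` smooth projective of dimension `n` over
  `ℂ` with `B(X)` in André's `*_L`-form (`∀ η, StandardConjectureBStar n X η`), every `u : Hᵃ(X(ℂ); ℂ) → Hᵇ(X(ℂ); ℂ)`,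
  `a + 2r = b ≤ 2n`, which is induced by an algebraic class on `X × X`, maps rational classes to rational classes
  and classes of type `(p, q)` to classes of type `(p + r, q + r)`, has a quasi-inverse `v` (`u v u = u`) induced
  by an algebraic class on `X × X`. `(Q) ⟹ (Q_H)` (`AlgebraicQuasiInverseOfLefschetzStandardHodge.of_algebraicQuasiInverse`,
  two hypotheses ignored). TRUE IN PRINT as a theorem under `B(X)` exactly as (Q) (André 1996 Prop. 3.3 +
  Appendix Remarque 1: the `′`-stable algebra of algebraic self-correspondences is semisimple, hence von Neumann
  regular; a rational element of the `ℂ`-span of algebraic classes lies in their `ℚ`-span) — a HYPOTHESIS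
  wherever used, never asserted, not vendored as a Literature fact.
* §T **ON-PATH, in the kernel, WITHOUT `B`**: `HodgeConjectureFor (n + n) (X ⊗ X) ⟹` the conclusion of (Q_H) at
  `X` (`exists_algebraic_quasiInverse_of_hodgeConjectureFor_sq`): ab-andre-2's quasi-inverse of a rational
  bidegree-`(r, r)` map (`exists_typeShift_pseudoInverse`, semisimplicity of polarisable Hodge structures) is
  rational of bidegree `(−r, −r)`, hence an algebraic correspondence under `HC(X × X)` (Voisin I Lemma 11.41,
  `isAlgebraicCorrespondence_of_hodgeConjectureFor_prod`). Hence
  `algebraicQuasiInverseOfLefschetzStandardHodge_of_hodgeConjecture : HodgeConjecture → (Q_H)`. For the full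
  node (Q) the same conclusion needs the semisimplicity of the `ℂ`-algebra spanned by algebraic correspondences,
  which the tree cannot express yet; (Q) stays print-true-under-`B(X)` and NOT on-path in the kernel — this is
  the reason for cutting it down.
* §U per pencil, with (Q_H) in place of (Q): `(Q_H) ∧ B(𝒳) ⟹` an algebraic quasi-inverse of each `L_t`
  (`L_t` is algebraic by XI §N, rational and of bidegree `(1,1)` by X-b §3); hence `(Q_H) ∧ (κ_f) ∧ B(𝒳) ⟹ (β′ᵖᵗ_f)`,
  `(Q_H) ∧ (φ_f) ∧ B(𝒳) ⟹ (A_f)`, `(Q_H) ∧ (κ_f) ∧ (φ_f) ∧ B(𝒳) ⟹ (β′_f)` — the proofs of part XI verbatim.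
* §V blanket and graded edges `(5∀) ⟹[Q_H; κ] (β∀′ᵖᵗ)`, `(5∀) ⟹[Q_H; κ, φ] (β∀′)`, `(5) ⟹[Q_H; κ] (β′ᵖᵗ)`,
  `(5) ⟹[Q_H; κ, φ] (β′)`, `(5)_d / (5∀)_d ⟹[Q_H; κ, φ] (β′)_d`; the row `HC_CM ⟹[h₂₁; Q_H, κ; (5)] HC_AV`; the
  rung `d = 2` from Tankeev 2011 (`h_T`) modulo `(Q_H), (κ), (φ)`; and `HodgeConjecture ⟹ (Q_H) ∧ (5∀)`
  (`quasiInverseHodge_and_lefschetzBCompactPencils_of_hodgeConjecture`, with part VI): BOTH brackets of the edge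
  are cases of the summit, and composing with `(5∀) ⟹[Q_H; κ, φ] (β∀′)` re-derives the statement of ab-andre-2's
  on-path theorem `HodgeConjecture ⟹[κ, φ] (β∀′)` (`fibreClassLefschetzOnCompactPencils_of_hodgeConjecture`, X-b,
  not restated) THROUGH the Lefschetz column: on the summit path the edge `(5) ⟹ (β′)` costs nothing beyond the
  two Hodge-theoretic supply nodes (κ), (φ) that (β′) itself contains.

## What is NOT claimed
Not that (Q_H), (Q), (κ), (φ) are proved (hypotheses; (Q_H) is proved only FROM `HodgeConjecture`); not
`(Q_H) ⟹ (Q)`; not that any node is "minimal" (F-ab-4); not `HC_AV ⟹ (5)` nor any monotonicity in `d`; not the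
converse `(β′) ⟹ (5)`; no edge of parts I–XI or X-a…X-e is revised; the `d = 2` rung rests on `h_T` exactly as in
parts X–XI (secondary-cited, LEAD label stands). (κ), (φ) are ab-andre-2's nodes; their discharge from the
Literature facts of `SmoothFamilyFibreClasses` (Deligne 1971, Fulton 1998) is ab-andre-2's/typer's row, not used here.

Discipline. HYPOTHESES, never facts: `Q_H`, `Q`, `κ`/`κ_f`, `φ`/`φ_f`, `(5∀)`, `(5)`, `(5∀)_d`, `(5)_d`, `h_T`,
`h₂₁` (`andre1996_cmAnchoredPencil`), `HC_CM`, `HodgeConjecture`. Literature keys cited: Andre1996Motifs (Prop.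
3.3 pp. 21–22; Appendix Remarque 1 p. 47; §2.1 p. 14; Lemme 6.3.1 p. 31; §6.3 Remarque 2 p. 33); Voisin2025
(Prop. 2.11, Lemma 2.9, §3.2.2); VoisinHodgeI2002 (§7.3, §11.3.3 Lemma 11.41); DeligneHodgeII1971 (Thm. 4.1.1,
4.2.6); Abdulali1994FamiliesAV (Conj. 5.3, Thm. 5.5 p. 1130); Tankeev2011 (main theorem); GreenMurreVoisin1994
(Murre §7.7–7.8). No `sorry`, no new axiom; one `@[conjecture] def` (Q_H).
-/

noncomputable section

-- The summit's namespace repeats `HodgeConjecture` (summit = sub-problem); every file of the axis disables this linter.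
set_option linter.dupNamespace false

namespace Summit.HodgeConjecture.HodgeConjecture.Ring2.AbelianAll

open CategoryTheory AlgebraicGeometry MonoidalCategory
open Literature.AlgebraicGeometry Literature.AlgebraicGeometry.Motives
open Literature.AlgebraicGeometry.HodgeTheory
open Literature.AlgebraicTopology.SingularHomology (singularCohomology cupProduct)
open Literature.AlgebraicGeometry.Andre1996 (andre1996_cmAnchoredPencil)
open Literature.AlgebraicGeometry.Deligne1982 (cmLocus)
open Literature.AlgebraicGeometry.Tankeev2011 (Tankeev2011_lefschetzStandard_abelianSurfacePencilThreefold)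
open Summit.HodgeConjecture.HodgeConjecture
open Summit.HodgeConjecture.HodgeConjecture.Theses
open Summit.HodgeConjecture.HodgeConjecture.Theorems (isAlgebraicCorrespondence_cupProduct_right)

variable {𝒳 S : SchemeOver ℂ}

/-! ## §S The supply node cut down to what the rows use: (Q_H) -/

/-- **(Q_H) `AlgebraicQuasiInverseOfLefschetzStandardHodge` — under `B(X)`, every algebraic self-correspondence
which is RATIONAL and of pure Hodge bidegree `(r, r)` has an algebraic quasi-inverse.** For `X` smooth projective
of dimension `n` over `ℂ` all of whose classes `η ∈ H²(X(ℂ); ℂ)` satisfy `StandardConjectureBStar n X η` (`B(X)` in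
André's `*_L`-form), and every `u : Hᵃ(X(ℂ); ℂ) → Hᵇ(X(ℂ); ℂ)` with `a + 2r = b ≤ 2n` which is induced by an
algebraic class on `X × X`, maps rational classes to rational classes and classes of Hodge type `(p, q)` to
classes of type `(p + r, q + r)` (a morphism of Hodge structures `Hᵃ(X) → Hᵇ(X)(r)` — e.g. `j_{t*} j_t^*` for a
smooth divisor `j_t`), there is `v : Hᵇ → Hᵃ` induced by an algebraic class on `X × X` with `u v u = u`. WEAKER
than part XI's (Q) (`of_algebraicQuasiInverse`); TRUE IN PRINT as a theorem under `B(X)` by the same chain (André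
1996 Prop. 3.3 and Appendix Remarque 1: the `′`-stable finite-dimensional `ℚ`-algebra of algebraic
self-correspondences is semisimple, hence von Neumann regular; a rational element of the `ℂ`-span of algebraic
classes lies in their `ℚ`-span); and — the point of this part — a THEOREM OF THE KERNEL under
`HodgeConjectureFor (n + n) (X ⊗ X)`, without `B` (`exists_algebraic_quasiInverse_of_hodgeConjectureFor_sq`,
`of_hodgeConjecture`). A SUPPLY NODE: a HYPOTHESIS wherever used, never asserted, not vendored as a Literature fact.
[cite: Andre1996Motifs, Prop. 3.3 (pp. 21–22), Appendix Remarque 1 (p. 47) and §2.1 (p. 14)]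
[cite: Voisin2025, Prop. 2.11 and Lemma 2.9] [cite: VoisinHodgeI2002, §7.3.1 Def. 7.22 and §11.3.3 Lemma 11.41] -/
@[conjecture] def AlgebraicQuasiInverseOfLefschetzStandardHodge : Prop :=
  ∀ ⦃n : ℕ⦄ ⦃X : SchemeOver ℂ⦄, IsSmoothProjective n X →
    (∀ η : complexBetti X 2, StandardConjectureBStar n X η) →
      ∀ ⦃a b r : ℕ⦄, a + 2 * r = b → b ≤ 2 * n →
        ∀ u : complexBetti X a →ₗ[ℂ] complexBetti X b, IsAlgebraicCorrespondence n n X X u →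
          (∀ c, IsRationalClass c → IsRationalClass (u c)) →
          (∀ (p q : ℕ), p + q = a → ∀ c, IsOfHodgeType n X a p q c → IsOfHodgeType n X b (p + r) (q + r) (u c)) →
            ∃ v : complexBetti X b →ₗ[ℂ] complexBetti X a,
              IsAlgebraicCorrespondence n n X X v ∧ ∀ x : complexBetti X a, u (v (u x)) = u x

/-! ## §T ON-PATH: `HC(X × X)` gives the conclusion of (Q_H) at `X`, without `B` -/

/-- **Under `HodgeConjectureFor (n + n) (X ⊗ X)` every rational bidegree-`(r, r)` map `u : Hᵃ(X) → H^{a+2r}(X)`,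
`a + 2r ≤ 2n`, has a quasi-inverse INDUCED BY AN ALGEBRAIC CLASS on `X × X`** (no `B`, no supply node, `u` need
not be algebraic): the rational bidegree-`(−r, −r)` quasi-inverse of ab-andre-2's `exists_typeShift_pseudoInverse`
(semisimplicity of polarisable Hodge structures) is an algebraic correspondence by Voisin I Lemma 11.41 and
`HC(X × X)` in codimension `n − r` (`isAlgebraicCorrespondence_of_hodgeConjectureFor_prod`).
[cite: Voisin2025, Prop. 2.11, Lemma 2.9 and §3.2.2] [cite: VoisinHodgeI2002, §11.3.3 Lemma 11.41] -/
theorem exists_algebraic_quasiInverse_of_hodgeConjectureFor_sq {n : ℕ} {X : SchemeOver ℂ}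
    (hX : IsSmoothProjective n X) (hHC : HodgeConjectureFor (n + n) (X ⊗ X)) {a b r : ℕ} (hab : a + 2 * r = b)
    (hb : b ≤ 2 * n) (u : complexBetti X a →ₗ[ℂ] complexBetti X b)
    (hu : ∀ c, IsRationalClass c → IsRationalClass (u c))
    (huH : ∀ (p q : ℕ), p + q = a → ∀ c, IsOfHodgeType n X a p q c → IsOfHodgeType n X b (p + r) (q + r) (u c)) :
    ∃ v : complexBetti X b →ₗ[ℂ] complexBetti X a,
      IsAlgebraicCorrespondence n n X X v ∧ (∀ c, IsRationalClass c → IsRationalClass (v c)) ∧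
        ∀ x : complexBetti X a, u (v (u x)) = u x := by
  obtain ⟨T, hTr, hTH, hT0, hTL⟩ := exists_typeShift_pseudoInverse hX hX hab u hu huH
  refine ⟨T, ?_, hTr, hTL⟩
  exact isAlgebraicCorrespondence_of_hodgeConjectureFor_prod hX hX hHC (e := n - r) (q := 2 * n - a)
    (by omega) (by omega) T hTr
    (fun p₁ q₁ hpq c hc p₂ q₂ hp₂ hq₂ ↦ hTH p₁ q₁ hpq c hc p₂ q₂ (by omega) (by omega))
    (fun p₁ q₁ hpq c hc hlt ↦ hT0 p₁ q₁ hpq c hc (by omega))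

namespace AlgebraicQuasiInverseOfLefschetzStandardHodge

/-- `(Q) ⟹ (Q_H)`: the cut-down node is weaker than part XI's (Q) (rationality and Hodge type are simply not
used). [cite: Andre1996Motifs, Prop. 3.3 (pp. 21–22) and Appendix Remarque 1 (p. 47)] -/
theorem of_algebraicQuasiInverse (hQ : AlgebraicQuasiInverseOfLefschetzStandard) :
    AlgebraicQuasiInverseOfLefschetzStandardHodge :=
  fun _ _ hX hB _ _ _ hab hb u hu _ _ ↦ hQ hX hB (by omega) hb u hu

/-- **ON-PATH: `HodgeConjecture ⟹ (Q_H)`** — the supply node of the edge `(5) ⟹ (β′)` in its cut-down form is a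
CASE of the summit (the Hodge conjecture for the `2n`-folds `X × X`; `B(X)` and the algebraicity of `u` unused).
[cite: Voisin2025, Prop. 2.11, Lemma 2.9 and §3.2.2] [cite: VoisinHodgeI2002, §11.3.3 Lemma 11.41] -/
theorem of_hodgeConjecture (h : _root_.HodgeConjecture) : AlgebraicQuasiInverseOfLefschetzStandardHodge := by
  intro n X hX _ a b r hab hb u _ hu huH
  obtain ⟨v, hv, -, hvu⟩ := exists_algebraic_quasiInverse_of_hodgeConjectureFor_sq hX
    (h (IsSmoothProjective.tensor_holds hX hX)) hab hb u hu huH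
  exact ⟨v, hv, hvu⟩

/-! ## §U Per pencil: `(Q_H) ∧ B(𝒳)` gives the algebraic quasi-inverse of `L_t`, hence (β′ᵖᵗ_f), (A_f), (β′_f) -/

/-- **`(Q_H) ∧ B(𝒳) ⟹` for EACH `t` and every `p ≤ d` the operator `L_t = j_{t*} j_t^*` on `H²ᵖ(𝒳)` has a
quasi-inverse INDUCED BY AN ALGEBRAIC CLASS on `𝒳 × 𝒳`**: `L_t` is algebraic (part XI §N), rational and of
bidegree `(1,1)` (ab-andre-2 X-b §3), so (Q_H) applies. [cite: Andre1996Motifs, Prop. 3.3 (pp. 21–22) and §6.3 Remarque 2 (p. 33)]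
[cite: VoisinHodgeI2002, §7.3.2 (with Lemma 7.30)] [cite: Abdulali1994FamiliesAV, Remark 5.4 and Theorem 5.5 (p. 1130)] -/
theorem exists_algebraic_quasiInverse_fiberGysin (hQ : AlgebraicQuasiInverseOfLefschetzStandardHodge) {d : ℕ}
    {f : 𝒳 ⟶ S} (hf : IsCompactAbelianPencil f d) (hB : ∀ η : complexBetti 𝒳 2, StandardConjectureBStar (d + 1) 𝒳 η)
    {p : ℕ} (hp : p ≤ d) (t : ComplexPoints S) :
    ∃ T : complexBetti 𝒳 (2 * (p + 1)) →ₗ[ℂ] complexBetti 𝒳 (2 * p),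
      IsAlgebraicCorrespondence (d + 1) (d + 1) 𝒳 𝒳 T ∧
        ∀ W : complexBetti 𝒳 (2 * p),
          fiberGysin hf t p (complexBetti.map (fiberι f t) (2 * p)
            (T (fiberGysin hf t p (complexBetti.map (fiberι f t) (2 * p) W)))) =
            fiberGysin hf t p (complexBetti.map (fiberι f t) (2 * p) W) := by
  set L : complexBetti 𝒳 (2 * p) →ₗ[ℂ] complexBetti 𝒳 (2 * (p + 1)) :=
    fiberGysin hf t p ∘ₗ (complexBetti.map (fiberι f t) (2 * p)).hom with hL
  have hLapp : ∀ W, L W = fiberGysin hf t p (complexBetti.map (fiberι f t) (2 * p) W) := fun _ ↦ rfl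
  obtain ⟨T, hT, hTL⟩ := hQ hf.isSmoothProjective_total hB (show 2 * p + 2 * 1 = 2 * (p + 1) by ring)
    (show 2 * (p + 1) ≤ 2 * (d + 1) by omega) L (isAlgebraicCorrespondence_fiberGysin_comp_map hf t hp)
    (fun c hc ↦ by rw [hLapp]; exact isRationalClass_fiberGysin_map_fiberι hf t hc)
    (fun p' q' _ c hc ↦ by rw [hLapp]; exact isOfHodgeType_fiberGysin_map_fiberι hf t hc)
  refine ⟨T, hT, fun W ↦ ?_⟩
  have h := hTL W
  simpa only [hLapp] using h

/-- **`(Q_H) ∧ (κ_f) ∧ B(𝒳) ⟹ (β′ᵖᵗ_f)`** (the correspondence may depend on `t`): `L_t (T_t L_t W − W) = 0`, so by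
(κ_f) `j_s^* (T_t L_t W − W) = 0` — part XI's proof with (Q_H). [cite: Andre1996Motifs, §6.3 Remarque 2 (p. 33)]
[cite: DeligneHodgeII1971, Thm. 4.1.1 and 4.2.6] [cite: Abdulali1994FamiliesAV, Theorem 5.5 (p. 1130)] -/
theorem fibreClassLefschetzPointwiseOn_of_standardConjectureBStar (hQ : AlgebraicQuasiInverseOfLefschetzStandardHodge)
    {d : ℕ} {f : 𝒳 ⟶ S} (hf : IsCompactAbelianPencil f d) (hκ : FibreGysinKernelOn hf)
    (hB : ∀ η : complexBetti 𝒳 2, StandardConjectureBStar (d + 1) 𝒳 η) : FibreClassLefschetzPointwiseOn hf := by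
  intro p hp t
  obtain ⟨T, hT, hTL⟩ := hQ.exists_algebraic_quasiInverse_fiberGysin hf hB hp t
  refine ⟨T, hT, fun W s ↦ ?_⟩
  rw [← sub_eq_zero, ← map_sub]
  refine hκ p t s _ ?_
  rw [map_sub, map_sub, hTL W, sub_self]

/-- **`(Q_H) ∧ (φ_f) ∧ B(𝒳) ⟹ (A_f)`**: under fibre-class constancy all `L_t` coincide, so the quasi-inverse at one
fibre serves every fibre; over an empty `S(ℂ)` any algebraic `H^{2p+2} → H²ᵖ` serves (one exists by (Q_H) applied
to the zero map `H²ᵖ → H^{2p+2}`, which is algebraic — cup product with the algebraic class `0` —, rational and of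
every bidegree). [cite: Andre1996Motifs, Prop. 3.3 (pp. 21–22) and §6.3 Remarque 2 (p. 33)] [cite: Fulton1998, §19.1 proof of Prop. 19.1.1] -/
theorem algebraicFibreClassQuasiInverseOn_of_standardConjectureBStar
    (hQ : AlgebraicQuasiInverseOfLefschetzStandardHodge) {d : ℕ} {f : 𝒳 ⟶ S} (hf : IsCompactAbelianPencil f d)
    (hφ : FibreClassConstantOn hf) (hB : ∀ η : complexBetti 𝒳 2, StandardConjectureBStar (d + 1) 𝒳 η) :
    AlgebraicFibreClassQuasiInverseOn hf := by
  intro p hp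
  rcases isEmpty_or_nonempty (ComplexPoints S) with hS | ⟨⟨t₀⟩⟩
  · -- no complex point: any algebraic correspondence of the right degrees serves
    have h𝒳 := hf.isSmoothProjective_total
    obtain ⟨A⟩ := nonempty_hodgeModel_holds h𝒳
    have h0 : IsAlgebraicCorrespondence (d + 1) (d + 1) 𝒳 𝒳
        (0 : complexBetti 𝒳 (2 * p) →ₗ[ℂ] complexBetti 𝒳 (2 * (p + 1))) := by
      have h := isAlgebraicCorrespondence_cupProduct_right h𝒳 (show 2 * p + 2 * 1 = 2 * (p + 1) by ring)
        (by omega) (Submodule.zero_mem (algebraicClasses 𝒳 1))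
      simpa only [map_zero] using h
    obtain ⟨T, hT, -⟩ := hQ h𝒳 hB (show 2 * p + 2 * 1 = 2 * (p + 1) by ring)
      (show 2 * (p + 1) ≤ 2 * (d + 1) by omega) 0 h0
      (fun _ _ ↦ by rw [LinearMap.zero_apply]; exact IsRationalClass.zero)
      (fun p' q' _ _ _ ↦ by rw [LinearMap.zero_apply]; exact IsOfHodgeType.zero A _ (p' + 1) (q' + 1))
    exact ⟨T, hT, fun t ↦ (IsEmpty.false t).elim⟩
  · obtain ⟨T, hT, hTL⟩ := hQ.exists_algebraic_quasiInverse_fiberGysin hf hB hp t₀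
    refine ⟨T, hT, fun t W ↦ ?_⟩
    rw [fiberGysin_map_fiberι_eq_of_const hf hφ t t₀ W, fiberGysin_map_fiberι_eq_of_const hf hφ t t₀, hTL W]

/-- **`(Q_H) ∧ (κ_f) ∧ (φ_f) ∧ B(𝒳) ⟹ (β′_f)`** (ab-andre-2's exact split `(β′_f) ⟺ (κ_f) ∧ (A_f)`).
[cite: Abdulali1994FamiliesAV, Conjecture 5.3 and Theorem 5.5 (p. 1130)] [cite: Andre1996Motifs, §6.3 Remarque 2 (p. 33)] -/
theorem fibreClassLefschetzOn_of_standardConjectureBStar (hQ : AlgebraicQuasiInverseOfLefschetzStandardHodge)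
    {d : ℕ} {f : 𝒳 ⟶ S} (hf : IsCompactAbelianPencil f d) (hκ : FibreGysinKernelOn hf) (hφ : FibreClassConstantOn hf)
    (hB : ∀ η : complexBetti 𝒳 2, StandardConjectureBStar (d + 1) 𝒳 η) : FibreClassLefschetzOn hf :=
  fibreClassLefschetzOn_of_kernel_of_quasiInverse hf hκ (hQ.algebraicFibreClassQuasiInverseOn_of_standardConjectureBStar hf hφ hB)

/-! ## §V Blanket and graded edges modulo (Q_H), (κ), (φ); the `HC_AV` row; the rung `d = 2`; consistency -/

/-- **`(5∀) ⟹[Q_H; κ] (β∀′ᵖᵗ)`.** [cite: Andre1996Motifs, §6.3 Remarque 2 (p. 33)] [cite: DeligneHodgeII1971, Thm. 4.1.1 and 4.2.6] -/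
theorem fibreClassLefschetzPointwiseCompactPencils_of_lefschetzBCompactPencils
    (hQ : AlgebraicQuasiInverseOfLefschetzStandardHodge) (hκ : FibreGysinKernelCompactPencils)
    (h₅ : LefschetzBCompactPencils) : FibreClassLefschetzPointwiseCompactPencils :=
  fun _ _ _ f hf ↦ hQ.fibreClassLefschetzPointwiseOn_of_standardConjectureBStar hf (hκ hf) (h₅ f hf)

/-- **`(5∀) ⟹[Q_H; κ, φ] (β∀′)`.** [cite: Andre1996Motifs, §6.3 Remarque 2 (p. 33)] [cite: Abdulali1994FamiliesAV, Theorem 5.5 (p. 1130)] -/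
theorem fibreClassLefschetzOnCompactPencils_of_lefschetzBCompactPencils
    (hQ : AlgebraicQuasiInverseOfLefschetzStandardHodge) (hκ : FibreGysinKernelCompactPencils)
    (hφ : FibreClassConstantCompactPencils) (h₅ : LefschetzBCompactPencils) : FibreClassLefschetzOnCompactPencils :=
  fun _ _ _ f hf ↦ hQ.fibreClassLefschetzOn_of_standardConjectureBStar hf (hκ hf) (hφ hf) (h₅ f hf)

/-- **`(5) ⟹[Q_H; κ] (β′ᵖᵗ)`** (CM-pointed compact pencils). [cite: Andre1996Motifs, Lemme 6.3.1 (p. 31) and §6.3 Remarque 2 (p. 33)] -/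
theorem fibreClassLefschetzPointwiseCMPointedPencils_of_lefschetzBCMPointedPencils
    (hQ : AlgebraicQuasiInverseOfLefschetzStandardHodge) (hκ : FibreGysinKernelCompactPencils)
    (h₅ : LefschetzBCMPointedPencils) : FibreClassLefschetzPointwiseCMPointedPencils :=
  fun _ _ _ f hf hcm ↦ hQ.fibreClassLefschetzPointwiseOn_of_standardConjectureBStar hf (hκ hf) (h₅ f hf hcm)

/-- **`(5) ⟹[Q_H; κ, φ] (β′)`** — the edge of REFEREE-AB R-09/R-10 (F-ab-37), kernel modulo three supply nodes
each of which is print-true, and (this part) with (Q_H) itself a case of the summit.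
[cite: Andre1996Motifs, Lemme 6.3.1 (p. 31) and §6.3 Remarque 2 (p. 33)] [cite: Abdulali1994FamiliesAV, Conjecture 5.3 (p. 1130)] -/
theorem fibreClassLefschetzOnCMPointedPencils_of_lefschetzBCMPointedPencils
    (hQ : AlgebraicQuasiInverseOfLefschetzStandardHodge) (hκ : FibreGysinKernelCompactPencils)
    (hφ : FibreClassConstantCompactPencils) (h₅ : LefschetzBCMPointedPencils) : FibreClassLefschetzOnCMPointedPencils :=
  fun _ _ _ f hf hcm ↦ hQ.fibreClassLefschetzOn_of_standardConjectureBStar hf (hκ hf) (hφ hf) (h₅ f hf hcm)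

/-- **Graded: `(5)_d ⟹[Q_H; κ, φ] (β′)_d`.** [cite: Andre1996Motifs, §6.3 Remarque 2 (p. 33)] -/
theorem fibreClassLefschetzOnAtRelDim_of_lefschetzBCMPointedPencilsAtRelDim
    (hQ : AlgebraicQuasiInverseOfLefschetzStandardHodge) {d : ℕ} (hκ : FibreGysinKernelCompactPencils)
    (hφ : FibreClassConstantCompactPencils) (h₅ : LefschetzBCMPointedPencilsAtRelDim d) :
    FibreClassLefschetzOnAtRelDim d :=
  fun _ _ f hf hcm ↦ hQ.fibreClassLefschetzOn_of_standardConjectureBStar hf (hκ hf) (hφ hf) (h₅ f hf hcm)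

/-- Graded: `(5∀)_d ⟹[Q_H; κ, φ] (β′)_d`. [cite: Andre1996Motifs, §6.3 Remarque 2 (p. 33)] -/
theorem fibreClassLefschetzOnAtRelDim_of_lefschetzBCompactPencilsAtRelDim
    (hQ : AlgebraicQuasiInverseOfLefschetzStandardHodge) {d : ℕ} (hκ : FibreGysinKernelCompactPencils)
    (hφ : FibreClassConstantCompactPencils) (h₅ : LefschetzBCompactPencilsAtRelDim d) :
    FibreClassLefschetzOnAtRelDim d :=
  hQ.fibreClassLefschetzOnAtRelDim_of_lefschetzBCMPointedPencilsAtRelDim hκ hφ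
    (lefschetzBCMPointedPencilsAtRelDim_of_lefschetzBCompactPencilsAtRelDim h₅)

/-- **The rung `(β′)_2` modulo (Q_H), (κ), (φ) and Tankeev's theorem `h_T`** (`B` for abelian-surface-fibred
threefolds). [cite: Tankeev2011, main theorem (κ(X) < 3)] [cite: Andre1996Motifs, §6.3 Remarque 2 (p. 33)] -/
theorem fibreClassLefschetzOnAtRelDim_two_of_tankeev2011 (hQ : AlgebraicQuasiInverseOfLefschetzStandardHodge)
    (hκ : FibreGysinKernelCompactPencils) (hφ : FibreClassConstantCompactPencils)
    (hT : Tankeev2011_lefschetzStandard_abelianSurfacePencilThreefold) : FibreClassLefschetzOnAtRelDim 2 :=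
  hQ.fibreClassLefschetzOnAtRelDim_of_lefschetzBCompactPencilsAtRelDim hκ hφ
    (lefschetzBCompactPencilsAtRelDim_two_of_tankeev2011 hT)

/-- **`(β′)_d` for every `d ≤ 2` modulo (Q_H), (κ), (φ), `h_T`.** [cite: Tankeev2011, main theorem (κ(X) < 3)]
[cite: GreenMurreVoisin1994, Murre §7.7 (PDF p. 123)] -/
theorem fibreClassLefschetzOnAtRelDim_of_le_two_of_tankeev2011 (hQ : AlgebraicQuasiInverseOfLefschetzStandardHodge)
    (hκ : FibreGysinKernelCompactPencils) (hφ : FibreClassConstantCompactPencils)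
    (hT : Tankeev2011_lefschetzStandard_abelianSurfacePencilThreefold) {d : ℕ} (hd : d ≤ 2) :
    FibreClassLefschetzOnAtRelDim d :=
  hQ.fibreClassLefschetzOnAtRelDim_of_lefschetzBCompactPencilsAtRelDim hκ hφ
    (lefschetzBCompactPencilsAtRelDim_of_le_two_of_tankeev2011 hT hd)

/-- **Granted (Q_H), (κ), (φ) and `h_T`, the node (β′) is EQUIVALENT to its restriction to relative dimension
`d ≥ 3`.** [cite: Tankeev2011, main theorem (κ(X) < 3)] [cite: Andre1996Motifs, §6.3 Remarque 2 (p. 33)] -/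
theorem fibreClassLefschetzOnCMPointedPencils_iff_forall_three_le_of_tankeev2011
    (hQ : AlgebraicQuasiInverseOfLefschetzStandardHodge) (hκ : FibreGysinKernelCompactPencils)
    (hφ : FibreClassConstantCompactPencils) (hT : Tankeev2011_lefschetzStandard_abelianSurfacePencilThreefold) :
    FibreClassLefschetzOnCMPointedPencils ↔ ∀ d : ℕ, 3 ≤ d → FibreClassLefschetzOnAtRelDim d := by
  refine ⟨fun h d _ _ _ _ hf hcm ↦ h hf hcm, fun h d _ _ _ hf hcm ↦ ?_⟩
  rcases Nat.lt_or_ge d 3 with hd | hd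
  · exact hQ.fibreClassLefschetzOnAtRelDim_of_le_two_of_tankeev2011 hκ hφ hT (by omega) hf hcm
  · exact h d hd hf hcm

end AlgebraicQuasiInverseOfLefschetzStandardHodge

/-- **ON-PATH lemma for the node (Q_H), in the cell's naming convention**: `HodgeConjecture ⟹ (Q_H)`.
[cite: Voisin2025, Prop. 2.11, Lemma 2.9 and §3.2.2] [cite: VoisinHodgeI2002, §11.3.3 Lemma 11.41] -/
theorem algebraicQuasiInverseOfLefschetzStandardHodge_of_hodgeConjecture (h : _root_.HodgeConjecture) :
    AlgebraicQuasiInverseOfLefschetzStandardHodge :=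
  AlgebraicQuasiInverseOfLefschetzStandardHodge.of_hodgeConjecture h

/-- **`HC_CM ⟹ HC_AV` along `(5)` modulo `h₂₁`, (Q_H), (κ)**: `(5) ⟹[Q_H; κ] (β′ᵖᵗ) ⟹ CM-fibre lift ⟹[h₂₁, HC_CM]
HC_AV` (ab-andre-2's kernel lift engine; part XI's row with (Q) cut down to (Q_H)).
research route, not a corollary; conditional on HC_CM plus one named minimal statement.
[cite: Andre1996Motifs, Lemme 6.3.1 (p. 31) and §6.3 a) (p. 33)] [cite: Abdulali1994FamiliesAV, Theorem 5.5 and Main Theorem 6.1 (b) (pp. 1130–1131)] -/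
theorem HC_AV_of_HC_CM_of_quasiInverseHodge_of_kernel_of_lefschetzBCMPointedPencils
    (h₂₁ : andre1996_cmAnchoredPencil) (hQ : AlgebraicQuasiInverseOfLefschetzStandardHodge)
    (hκ : FibreGysinKernelCompactPencils) (hCM : RankFourFaces.CMAbelianHodge) (h₅ : LefschetzBCMPointedPencils) :
    PadicSemiregularLift.HodgeAbelianVarieties :=
  HC_AV_of_HC_CM_and_fibreClassLefschetzPointwiseCMPointedPencils h₂₁ hCM
    (hQ.fibreClassLefschetzPointwiseCMPointedPencils_of_lefschetzBCMPointedPencils hκ h₅)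

/-- **Both brackets of the Lefschetz-column edge are CASES OF THE SUMMIT**: `HodgeConjecture ⟹ (Q_H) ∧ (5∀)`
((Q_H) by §T, (5∀) by part VI's `lefschetzBCompactPencils_of_hodgeConjecture_holds`). CONSISTENCY SQUARE: composing
this with §V's `(5∀) ⟹[Q_H; κ, φ] (β∀′)` yields exactly the statement of ab-andre-2's on-path theorem
`fibreClassLefschetzOnCompactPencils_of_hodgeConjecture` (X-b; not restated here) — on the summit path the edge
`(5) ⟹ (β′)` costs nothing beyond the two Hodge-theoretic supply nodes (κ), (φ) that (β′) itself contains.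
[cite: Voisin2025, Prop. 2.11, §3.2.2 and Conj. 3.11] [cite: Andre1996Motifs, §6.3 Remarque 2 (p. 33)] -/
theorem quasiInverseHodge_and_lefschetzBCompactPencils_of_hodgeConjecture (h : _root_.HodgeConjecture) :
    AlgebraicQuasiInverseOfLefschetzStandardHodge ∧ LefschetzBCompactPencils :=
  ⟨AlgebraicQuasiInverseOfLefschetzStandardHodge.of_hodgeConjecture h, lefschetzBCompactPencils_of_hodgeConjecture_holds h⟩

/-- **The edge table of this part in one statement** (each arrow a theorem of this file; (Q_H) a case of the
summit by `of_hodgeConjecture`, (κ), (φ) ab-andre-2's print-true supply nodes, `h_T` Tankeev 2011):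
`(Q) ⟹ (Q_H)`, `HC ⟹ (Q_H)`, and modulo (Q_H): `(5∀) ⟹ (β∀′ᵖᵗ)`, `(5∀) ⟹ (β∀′)`, `(5) ⟹ (β′ᵖᵗ)`, `(5) ⟹ (β′)`,
`h_T ⟹ (β′)_2`. [cite: Andre1996Motifs, §6.3 Remarque 2 (p. 33)] [cite: Tankeev2011, main theorem (κ(X) < 3)] -/
theorem lefschetzB_to_fibreClass_chain_hodge (hκ : FibreGysinKernelCompactPencils) (hφ : FibreClassConstantCompactPencils) :
    (AlgebraicQuasiInverseOfLefschetzStandard → AlgebraicQuasiInverseOfLefschetzStandardHodge) ∧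
      (_root_.HodgeConjecture → AlgebraicQuasiInverseOfLefschetzStandardHodge) ∧
      (AlgebraicQuasiInverseOfLefschetzStandardHodge →
        (LefschetzBCompactPencils → FibreClassLefschetzPointwiseCompactPencils) ∧
          (LefschetzBCompactPencils → FibreClassLefschetzOnCompactPencils) ∧
          (LefschetzBCMPointedPencils → FibreClassLefschetzPointwiseCMPointedPencils) ∧
          (LefschetzBCMPointedPencils → FibreClassLefschetzOnCMPointedPencils) ∧
          (Tankeev2011_lefschetzStandard_abelianSurfacePencilThreefold → FibreClassLefschetzOnAtRelDim 2)) :=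
  ⟨AlgebraicQuasiInverseOfLefschetzStandardHodge.of_algebraicQuasiInverse,
    AlgebraicQuasiInverseOfLefschetzStandardHodge.of_hodgeConjecture,
    fun hQ ↦ ⟨hQ.fibreClassLefschetzPointwiseCompactPencils_of_lefschetzBCompactPencils hκ,
      hQ.fibreClassLefschetzOnCompactPencils_of_lefschetzBCompactPencils hκ hφ,
      hQ.fibreClassLefschetzPointwiseCMPointedPencils_of_lefschetzBCMPointedPencils hκ,
      hQ.fibreClassLefschetzOnCMPointedPencils_of_lefschetzBCMPointedPencils hκ hφ,
      hQ.fibreClassLefschetzOnAtRelDim_two_of_tankeev2011 hκ hφ⟩⟩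

end Summit.HodgeConjecture.HodgeConjecture.Ring2.AbelianAll

end
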